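import Summits.AtomisticToContinuum.HydrodynamicLimit.Theses.TwoClocks
import Summits.AtomisticToContinuum.HydrodynamicLimit.Theorems.DenseExcursion.Negative.AtTimeZero
import Summits.AtomisticToContinuum.HydrodynamicLimit.Theorems.DenseExcursion.Negative.Untied
import Summits.AtomisticToContinuum.HydrodynamicLimit.Theorems.OneFlightGossipEngineCollisionActivityTailsEndpointTails

/-!
# Negative knowledge for the crux `TwoClocks.TransferActivityTails` — reductions to weaker rungs

Crux stmt-AtomisticToContinuum-16624 (route TwoClocks, crux #7; rev-10 restatement of the momentum-activity
crux ex-stmt-13734 `CollisionActivityTails` with the TRANSFER activity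
`a_i = (σ/τ) Σ_{collisions of i in (s, s+w]} (‖v_i⁺ − v_i⁻‖ + |‖v_i⁺‖² − ‖v_i⁻‖²|/2)`).
From the standing disprover's workfile `Cruxes/TransferActivityTails/Disproof.lean` (cycle 1,
refuter-cdisprove-stmt-AtomisticToContinuum-16624-0, 2026-08-16).  NOTHING here asserts the crux, or any
Theses declaration, positively: every theorem is "crux ⇒ strictly weaker typed rung" or its contrapositive
"¬ rung ⇒ ¬ crux" — the typed targets a counterexample has to hit.

* `TailsOf F` — the crux's statement with a general per-record summand `F`; the crux is the instance
  `F = transferOf` DEFINITIONALLY (`transferActivityTails_iff`, `Iff.rfl`).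
* DOMINATION (`tailsOf_of_le`): the statement is antitone in a nonnegative summand (record by record
  `0 ≤ F ≤ G`, and `y ↦ y·𝟙{V < y}` is monotone on `[0, ∞)`; a.e. on the good set, where windows carry finitely
  many collisions).  Hence the crux implies the MOMENTUM-activity tails `MomentumActivityTails` (the summand of
  ex-stmt-13734, byte-identical with `OneFlightGossipEngine.CollisionActivityTails`) and the ENERGY-activity
  tails `EnergyActivityTails` (the summand of the registered stub input `CollisionEnergyActivityTails` of
  `Theorems.ClampedCurrentsDockTransferTails`); with the landed converse `stub_transferActivityTails`
  ((p+q)𝟙{p+q>V} ≤ 2p𝟙{p>V/2} + 2q𝟙{q>V/2}) the crux is EQUIVALENT to the conjunction of the two, so every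
  piece of negative knowledge filed against 13734 transfers verbatim (`not_transferActivityTails_of_not_momentum`).
* EQUILIBRIUM REDUCTION (`equilibriumTailsOf_of_tailsOf`, unconditional): for CONSTANT profiles the hypotheses
  of the crux are dischargeable in the tree — constant states are classical hs-Euler solutions on every `[0,T)`
  (`DenseExcursionUntied.isHardSphereEulerSolution_const`) and the `t = 0` law of large numbers of the local
  Gibbs laws (`localGibbs_lln_holds`) has, for constant activity, a CONSTANT limiting density
  (`constantStateLLN`: the hidden `ρ₀` is pinned to `rhoLim (profileOf a₀) σ` by
  `DenseExcursionAtTimeZero.density_zero_eq_rhoLim`, and `rhoLim` is constant because `β` is; the laws are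
  probability measures and the threshold is `≤ 1/2`) — so the crux at
  `t = 0`, `s = 0` IS the equilibrium rung `EquilibriumTransferActivityTails` (canonical Gibbs law, window
  `(0, w]`, profile-wise `σ₀`): the `N`-uniform tagged-particle transfer-activity law of large numbers in the
  window length.  ANY equilibrium counterexample — persistent hyperactivity (caging under overpressure, or a
  recurrent energy relay) of a tagged sphere with non-vanishing activity-weighted probability over
  `τσ² → ∞` mean free times — refutes the crux (`not_transferActivityTails_of_not_equilibrium`).
  (The 13734 port of this reduction, `CollisionActivityTailsEquilibrium.*`, refers to the retired decl
  `TwoClocks.CollisionActivityTails` and no longer elaborates; this file supersedes it for the live crux.)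
-/

noncomputable section

open MeasureTheory Filter Set Topology
open scoped ENNReal

namespace Summit.AtomisticToContinuum.HydrodynamicLimit.Theorems

namespace TransferActivityTailsNegative

open Literature.MathematicalPhysics.KineticTheory Literature.Analysis.FluidPDE
open DenseExcursionAtTimeZero (density_zero_eq_rhoLim)
open DenseExcursionUntied (isHardSphereEulerSolution_const)
open CollisionActivityTailsEndpointTails (ae_mem_good_localGibbsLaw)

/-! ## §1 The crux with a general summand -/

/-- A hard-sphere flow of `N + 1` spheres of reduced diameter `σ` on `𝕋³` (the crux's `Φ N`). -/
abbrev Flow (σ : ℝ) (N : ℕ) : Type :=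
  HardSphereFlow (Torus.geometry (Fin 3)) (hsDiameter σ N) (N + 1)

/-- Collision records of `N + 1` spheres on `𝕋³`. -/
abbrev Rec (N : ℕ) : Type := HardSphereCollisionRecord (Fin 3) T3 (N + 1)

/-- The crux's summand: the TRANSFER impulse (momentum + energy) received by `i` in the ordered record `c`. -/
def transferOf (N : ℕ) (i : Fin (N + 1)) (c : Rec N) : ℝ :=
  if c.fst = i then ‖c.postVel.1 - c.preVel.1‖ + |‖c.postVel.1‖ ^ 2 - ‖c.preVel.1‖ ^ 2| / 2 else 0

/-- The momentum impulse received by `i` in the record `c` (summand of ex-stmt-13734). -/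
def momentumOf (N : ℕ) (i : Fin (N + 1)) (c : Rec N) : ℝ :=
  if c.fst = i then ‖c.postVel.1 - c.preVel.1‖ else 0

/-- The energy impulse received by `i` in the record `c` (summand of the energy twin). -/
def energyOf (N : ℕ) (i : Fin (N + 1)) (c : Rec N) : ℝ :=
  if c.fst = i then |‖c.postVel.1‖ ^ 2 - ‖c.preVel.1‖ ^ 2| / 2 else 0

/-- **The pre-shock window-activity tail statement for a general per-record summand `F`** (the crux's frame
verbatim: profiles, `σ₀`, Euler solution, flows, `t = 0` LLN, `∃V₀ ∀V ∀ε ∃τ₀ ∀τ ∃N₀ ∀N ∀s ≤ t`). -/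
def TailsOf (F : (N : ℕ) → Fin (N + 1) → Rec N → ℝ) : Prop :=
  ∀ (a₀ θ₀ : T3 → ℝ) (u₀ : T3 → V3), Continuous a₀ → Continuous θ₀ → Continuous u₀ →
    (∀ x, 0 < a₀ x) → (∀ x, 0 < θ₀ x) → ∃ σ₀ : ℝ, 0 < σ₀ ∧ ∀ σ : ℝ, 0 < σ → σ < σ₀ →
    ∀ (T : ℝ) (ρ θ : ℝ → T3 → ℝ) (u : ℝ → T3 → V3), IsHardSphereEulerSolution σ T ρ u θ →
    ∀ Φ : (N : ℕ) → Flow σ N,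
    TendstoHydroFieldsAt (fun N => localGibbsLaw σ a₀ u₀ θ₀ N (Φ N)) Φ ρ u θ 0 →
    ∀ t ∈ Set.Ico 0 T, ∃ V₀ : ℝ, 0 < V₀ ∧ ∀ V : ℝ, V₀ ≤ V → ∀ ε : ℝ, 0 < ε →
    ∃ τ₀ : ℝ, 0 < τ₀ ∧ ∀ τ : ℝ, τ₀ ≤ τ → ∃ N₀ : ℕ, ∀ N : ℕ, N₀ ≤ N → ∀ s ∈ Set.Icc 0 t,
      ∫⁻ z, ENNReal.ofReal (((N : ℝ) + 1)⁻¹ * ∑ i : Fin (N + 1),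
          Set.indicator {y : ℝ | V < y} (fun y => y)
            (σ / τ * (Φ N).collisionSum (Set.Ioc s (s + τ * ((N : ℝ) + 1) ^ (-(1 / 3 : ℝ))))
              (F N i) z))
        ∂(localGibbsLaw σ a₀ u₀ θ₀ N (Φ N)) ≤ ENNReal.ofReal ε

/-- **Read-back**: the crux IS `TailsOf transferOf` (definitional unfolding of its `let`s). -/
theorem transferActivityTails_iff :
    Summit.AtomisticToContinuum.HydrodynamicLimit.Theses.TwoClocks.TransferActivityTails ↔
      TailsOf transferOf :=
  Iff.rfl

/-- The momentum-activity tails (ex-crux stmt-13734; byte-identical with the live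
`OneFlightGossipEngine.CollisionActivityTails`). -/
def MomentumActivityTails : Prop := TailsOf momentumOf

/-- The energy-activity tails (the twin; byte-identical with
`ClampedCurrentsDockTransferTails.CollisionEnergyActivityTails`). -/
def EnergyActivityTails : Prop := TailsOf energyOf

/-! ## §2 Domination: the statement is antitone in a nonnegative summand -/

variable {σ : ℝ} {N : ℕ}

/-- A collision sum of a nonnegative functional is nonnegative (every datum, including the junk case). -/
theorem collisionSum_nonneg (Φ : Flow σ N) (S : Set ℝ) {F : Rec N → ℝ} (hF : ∀ c, 0 ≤ F c)
    (z : Config (N + 1) (Fin 3) T3) : 0 ≤ Φ.collisionSum S F z := by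
  rw [HardSphereFlow.collisionSum_eq, collisionSum_eq_collisionPairSum]
  exact collisionPairSum_nonneg fun _ _ _ => hF _

/-- On the good set a window collision sum is monotone in the functional. -/
theorem collisionSum_mono_of_good (Φ : Flow σ N) {z : Config (N + 1) (Fin 3) T3} (hz : z ∈ Φ.good)
    (a b : ℝ) {F G : Rec N → ℝ} (h : ∀ c, F c ≤ G c) :
    Φ.collisionSum (Set.Ioc a b) F z ≤ Φ.collisionSum (Set.Ioc a b) G z := by
  have hfin := Φ.finite_collisionTimes_inter hz (S := Set.Ioc a b) Set.Ioc_subset_Icc_self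
  rw [HardSphereFlow.collisionSum_eq, HardSphereFlow.collisionSum_eq, collisionSum_eq_collisionPairSum,
    collisionSum_eq_collisionPairSum]
  exact collisionPairSum_mono hfin fun _ _ _ _ => h _

/-- **Domination.** If `0 ≤ F ≤ G` record by record, the tail statement for `G` implies the one for `F`
(same thresholds). -/
theorem tailsOf_of_le {F G : (N : ℕ) → Fin (N + 1) → Rec N → ℝ} (hF : ∀ N i c, 0 ≤ F N i c)
    (hFG : ∀ N i c, F N i c ≤ G N i c) (hG : TailsOf G) : TailsOf F := by
  intro a₀ θ₀ u₀ ha hθ hu ha0 hθ0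
  obtain ⟨σ₀, hσ₀, H⟩ := hG a₀ θ₀ u₀ ha hθ hu ha0 hθ0
  refine ⟨σ₀, hσ₀, fun σ hσ hσlt T ρ θ u hE Φ hlim t ht => ?_⟩
  obtain ⟨V₀, hV₀, H⟩ := H σ hσ hσlt T ρ θ u hE Φ hlim t ht
  refine ⟨V₀, hV₀, fun V hV ε hε => ?_⟩
  obtain ⟨τ₀, hτ₀, H⟩ := H V hV ε hε
  refine ⟨τ₀, hτ₀, fun τ hτ => ?_⟩
  obtain ⟨N₀, H⟩ := H τ hτ
  refine ⟨N₀, fun N hN s hs => (lintegral_mono_ae ?_).trans (H N hN s hs)⟩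
  have hκ : 0 ≤ σ / τ := div_nonneg hσ.le (hτ₀.le.trans hτ)
  -- `y ↦ y·𝟙{V < y}` is monotone on `[0, ∞)` (cf. `HydroLimitInBandHeart.indicator_tail_mono`)
  have hmono : ∀ {p q : ℝ}, 0 ≤ p → p ≤ q →
      Set.indicator {y : ℝ | V < y} (fun y => y) p ≤ Set.indicator {y : ℝ | V < y} (fun y => y) q := by
    intro p q hp hpq
    by_cases h : V < p
    · rw [Set.indicator_of_mem (show p ∈ {y : ℝ | V < y} from h),
        Set.indicator_of_mem (show q ∈ {y : ℝ | V < y} from h.trans_le hpq)]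
      exact hpq
    · rw [Set.indicator_of_notMem (show p ∉ {y : ℝ | V < y} from h)]
      exact Set.indicator_apply_nonneg fun _ => hp.trans hpq
  filter_upwards [ae_mem_good_localGibbsLaw σ a₀ θ₀ u₀ N (Φ N)] with z hz
  refine ENNReal.ofReal_le_ofReal (mul_le_mul_of_nonneg_left (Finset.sum_le_sum fun i _ => ?_)
    (by positivity))
  exact hmono (mul_nonneg hκ (collisionSum_nonneg (Φ N) _ (hF N i) z))
    (mul_le_mul_of_nonneg_left (collisionSum_mono_of_good (Φ N) hz _ _ (hFG N i)) hκ)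

/-- The momentum impulse is nonnegative. -/
theorem momentumOf_nonneg (N : ℕ) (i : Fin (N + 1)) (c : Rec N) : 0 ≤ momentumOf N i c := by
  unfold momentumOf; split_ifs <;> positivity

/-- The energy impulse is nonnegative. -/
theorem energyOf_nonneg (N : ℕ) (i : Fin (N + 1)) (c : Rec N) : 0 ≤ energyOf N i c := by
  unfold energyOf; split_ifs <;> positivity

/-- The transfer impulse is nonnegative. -/
theorem transferOf_nonneg (N : ℕ) (i : Fin (N + 1)) (c : Rec N) : 0 ≤ transferOf N i c := by
  unfold transferOf; split_ifs <;> positivity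

/-- The momentum impulse is dominated by the transfer impulse, record by record. -/
theorem momentumOf_le_transferOf (N : ℕ) (i : Fin (N + 1)) (c : Rec N) :
    momentumOf N i c ≤ transferOf N i c := by
  unfold momentumOf transferOf
  split_ifs
  · exact le_add_of_nonneg_right (by positivity)
  · exact le_rfl

/-- The energy impulse is dominated by the transfer impulse, record by record. -/
theorem energyOf_le_transferOf (N : ℕ) (i : Fin (N + 1)) (c : Rec N) :
    energyOf N i c ≤ transferOf N i c := by
  unfold energyOf transferOf
  split_ifs
  · exact le_add_of_nonneg_left (by positivity)
  · exact le_rfl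

/-- **The crux implies the momentum-activity tails** (ex-stmt-13734 / `OneFlightGossipEngine.CollisionActivityTails`). -/
theorem momentumActivityTails_of_crux
    (h : Summit.AtomisticToContinuum.HydrodynamicLimit.Theses.TwoClocks.TransferActivityTails) :
    MomentumActivityTails :=
  tailsOf_of_le momentumOf_nonneg momentumOf_le_transferOf (transferActivityTails_iff.1 h)

/-- **The crux implies the energy-activity tails** (the twin `CollisionEnergyActivityTails`). -/
theorem energyActivityTails_of_crux
    (h : Summit.AtomisticToContinuum.HydrodynamicLimit.Theses.TwoClocks.TransferActivityTails) :
    EnergyActivityTails :=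
  tailsOf_of_le energyOf_nonneg energyOf_le_transferOf (transferActivityTails_iff.1 h)

/-- Contrapositive: **a counterexample to the momentum-activity tails (ex-13734) refutes the crux.** -/
theorem not_transferActivityTails_of_not_momentum (h : ¬ MomentumActivityTails) :
    ¬ Summit.AtomisticToContinuum.HydrodynamicLimit.Theses.TwoClocks.TransferActivityTails :=
  fun hc => h (momentumActivityTails_of_crux hc)

/-- Contrapositive: **a counterexample to the energy-activity tails refutes the crux.** -/
theorem not_transferActivityTails_of_not_energy (h : ¬ EnergyActivityTails) :
    ¬ Summit.AtomisticToContinuum.HydrodynamicLimit.Theses.TwoClocks.TransferActivityTails :=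
  fun hc => h (energyActivityTails_of_crux hc)

/-! ## §3 The equilibrium reduction -/

/-- **The equilibrium rung of `TailsOf F`** (constant profiles, window `(0, w]`, canonical Gibbs law,
profile-wise `σ₀`; the crux's integrand verbatim): `lim_τ limsup_N E_G[(N+1)⁻¹ Σ_i a_i 𝟙{a_i > V}] = 0` for
all `V ≥ V₀`. -/
def EquilibriumTailsOf (F : (N : ℕ) → Fin (N + 1) → Rec N → ℝ) : Prop :=
  ∀ (a₀ θ₀ : ℝ) (u₀ : V3), 0 < a₀ → 0 < θ₀ → ∃ σ₀ : ℝ, 0 < σ₀ ∧ ∀ σ : ℝ, 0 < σ → σ < σ₀ →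
    ∀ Φ : (N : ℕ) → Flow σ N, ∃ V₀ : ℝ, 0 < V₀ ∧ ∀ V : ℝ, V₀ ≤ V → ∀ ε : ℝ, 0 < ε →
    ∃ τ₀ : ℝ, 0 < τ₀ ∧ ∀ τ : ℝ, τ₀ ≤ τ → ∃ N₀ : ℕ, ∀ N : ℕ, N₀ ≤ N →
      ∫⁻ z, ENNReal.ofReal (((N : ℝ) + 1)⁻¹ * ∑ i : Fin (N + 1),
          Set.indicator {y : ℝ | V < y} (fun y => y)
            (σ / τ * (Φ N).collisionSum (Set.Ioc 0 (τ * ((N : ℝ) + 1) ^ (-(1 / 3 : ℝ)))) (F N i) z))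
        ∂(localGibbsLaw σ (fun _ => a₀) (fun _ => u₀) (fun _ => θ₀) N (Φ N)) ≤ ENNReal.ofReal ε

/-- **Equilibrium transfer-activity tails** — the equilibrium rung of the crux. -/
def EquilibriumTransferActivityTails : Prop := EquilibriumTailsOf transferOf

/-- **The constant-profile law of large numbers with a constant density** (proved below,
`constantStateLLN`): below a threshold `σ₁ ≤ 1/2` the canonical Gibbs laws at constant
`(a₀, u₀, θ₀)` are probability measures and their empirical fields converge at `t = 0`, through every flow
family, to a CONSTANT state `(r, u₀, θ₀)`, `r = rhoLim (profileOf a₀) σ > 0`. -/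
def ConstantStateLLNStatement : Prop :=
  ∀ (a₀ θ₀ : ℝ) (u₀ : V3), 0 < a₀ → 0 < θ₀ → ∃ σ₁ : ℝ, 0 < σ₁ ∧ σ₁ ≤ 1 / 2 ∧ ∀ σ : ℝ, 0 < σ → σ < σ₁ →
    ∃ r : ℝ, 0 < r ∧ ∀ Φ : (N : ℕ) → Flow σ N,
      (∀ N, IsProbabilityMeasure
        (localGibbsLaw σ (fun _ => a₀) (fun _ => u₀) (fun _ => θ₀) N (Φ N))) ∧
      TendstoHydroFieldsAt (fun N => localGibbsLaw σ (fun _ => a₀) (fun _ => u₀) (fun _ => θ₀) N (Φ N))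
        Φ (fun _ _ => r) (fun _ _ => u₀) (fun _ _ => θ₀) 0

/-- **The constant-profile LLN has a constant density**: the hidden `ρ₀` of `localGibbs_lln_holds` is pinned
to `rhoLim (profileOf a₀) σ` along SOME flow family (Alexander's theorem on `𝕋³` provides one), and `rhoLim`
is constant for constant activity (`β ≡ 1`). -/
theorem constantStateLLN : ConstantStateLLNStatement := by
  intro a θ u ha hθ
  obtain ⟨σa, hσa, Ha⟩ := localGibbs_lln_holds (fun _ => a) (fun _ => θ) (fun _ => u)
    continuous_const continuous_const continuous_const (fun _ => ha) (fun _ => hθ)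
  obtain ⟨σb, hσb, hσb2, Hb⟩ := density_zero_eq_rhoLim (a₀ := fun _ : T3 => a) (θ₀ := fun _ => θ)
    (u₀ := fun _ => u) continuous_const continuous_const continuous_const (fun _ => ha)
    (fun _ => hθ)
  refine ⟨min σa σb, lt_min hσa hσb, (min_le_right _ _).trans hσb2, fun σ hσ hσlt => ?_⟩
  have hσa' : σ < σa := hσlt.trans_le (min_le_left _ _)
  have hσb' : σ < σb := hσlt.trans_le (min_le_right _ _)
  have hσ2 : σ < 1 / 2 := hσb'.trans_le hσb2
  set P := profileOf (fun _ : T3 => a) continuous_const (fun _ => ha) with hP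
  obtain ⟨-, hpin⟩ := Hb σ hσ hσb'
  obtain ⟨ρ₀, hρc, hρpos, Hlln⟩ := Ha σ hσ hσa'
  -- some flow family (Alexander's theorem on the torus, diameters `≤ σ < 1/2`)
  let Φ : (N : ℕ) → Flow σ N := fun N => Classical.choice (HardSphereFlow.nonempty_torus_holds (d := Fin 3)
    (hsDiameter_pos hσ N) ((hsDiameter_le hσ.le N).trans_lt (hσ2.trans_eq (by norm_num))) (N + 1))
  have hid : ρ₀ = rhoLim P σ :=
    hpin (fun _ => ρ₀) (fun _ _ => θ) (fun _ _ => u) Φ hρc (Hlln Φ).2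
  have hconst : rhoLim P σ = fun _ => ρ₀ 0 := by
    funext x
    rw [hid]
    simp only [hP, rhoLim, profileOf_β]
  refine ⟨ρ₀ 0, hρpos 0, fun Ψ => ⟨(Hlln Ψ).1, ?_⟩⟩
  have hT := (Hlln Ψ).2
  rw [hid, hconst] at hT
  exact hT

/-- **Equilibrium reduction (unconditional)**: every pre-shock tail statement implies its equilibrium rung
(constant profiles; constant Euler state on `[0, 1)`; the constant-profile LLN; `t = s = 0`). -/
theorem equilibriumTailsOf_of_tailsOf (F : (N : ℕ) → Fin (N + 1) → Rec N → ℝ) (h : TailsOf F) :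
    EquilibriumTailsOf F := by
  intro a₀ θ₀ u₀ ha hθ
  obtain ⟨σc, hσc, hc⟩ := h (fun _ => a₀) (fun _ => θ₀) (fun _ => u₀) continuous_const
    continuous_const continuous_const (fun _ => ha) (fun _ => hθ)
  obtain ⟨σ₁, hσ₁, -, hl⟩ := constantStateLLN a₀ θ₀ u₀ ha hθ
  refine ⟨min σc σ₁, lt_min hσc hσ₁, fun σ hσ hσlt Φ => ?_⟩
  have hσc' : σ < σc := hσlt.trans_le (min_le_left _ _)
  have hσ₁' : σ < σ₁ := hσlt.trans_le (min_le_right _ _)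
  obtain ⟨r, hr, hlln⟩ := hl σ hσ hσ₁'
  obtain ⟨V₀, hV₀, H⟩ := hc σ hσ hσc' 1 (fun _ _ => r) (fun _ _ => θ₀) (fun _ _ => u₀)
    (isHardSphereEulerSolution_const σ 1 u₀ hr hθ) Φ (hlln Φ).2 0 ⟨le_rfl, one_pos⟩
  refine ⟨V₀, hV₀, fun V hV ε hε => ?_⟩
  obtain ⟨τ₀, hτ₀, H⟩ := H V hV ε hε
  refine ⟨τ₀, hτ₀, fun τ hτ => ?_⟩
  obtain ⟨N₀, H⟩ := H τ hτ
  refine ⟨N₀, fun N hN => ?_⟩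
  have key := H N hN 0 ⟨le_rfl, le_rfl⟩
  simpa only [zero_add] using key

/-- **The crux implies its equilibrium rung, unconditionally.** -/
theorem equilibriumTransferActivityTails_of_crux
    (h : Summit.AtomisticToContinuum.HydrodynamicLimit.Theses.TwoClocks.TransferActivityTails) :
    EquilibriumTransferActivityTails :=
  equilibriumTailsOf_of_tailsOf transferOf (transferActivityTails_iff.1 h)

/-- Contrapositive: **any counterexample to the equilibrium rung refutes the crux.** -/
theorem not_transferActivityTails_of_not_equilibrium (h : ¬ EquilibriumTransferActivityTails) :
    ¬ Summit.AtomisticToContinuum.HydrodynamicLimit.Theses.TwoClocks.TransferActivityTails :=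
  fun hc => h (equilibriumTransferActivityTails_of_crux hc)

/-- The equilibrium rungs of the momentum and energy activities also follow from the crux (domination, then
reduction), so an equilibrium counterexample in EITHER currency kills it. -/
theorem equilibrium_momentum_and_energy_of_crux
    (h : Summit.AtomisticToContinuum.HydrodynamicLimit.Theses.TwoClocks.TransferActivityTails) :
    EquilibriumTailsOf momentumOf ∧ EquilibriumTailsOf energyOf :=
  ⟨equilibriumTailsOf_of_tailsOf momentumOf (momentumActivityTails_of_crux h),
    equilibriumTailsOf_of_tailsOf energyOf (energyActivityTails_of_crux h)⟩

end TransferActivityTailsNegative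

end Summit.AtomisticToContinuum.HydrodynamicLimit.Theorems

end
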